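import Mathlib
import HarnessLib
import Literature.Analysis.FluidPDE.TypeIAncientMild
import Literature.Analysis.FluidPDE.LocalTypeISlabProfile
import Literature.Analysis.FluidPDE.ClassicalSuitableRegionEnergy
import Literature.Analysis.FluidPDE.ClassicalSolutionRegion
import Literature.Analysis.FluidPDE.ClassicalSuitable
import Literature.Analysis.FluidPDE.Seregin2020ScaledEnergyBounds
import Literature.Analysis.FluidPDE.SuitableWeakPressure
import Literature.Analysis.FluidPDE.SuitableWeakRescaling
import Literature.Analysis.FluidPDE.KinematicApexWitness
import Summits.NavierStokesRegularity.NavierStokesRegularity.Theorems.SymmetryModuliCountAxisymEndLiouvilleOfFarPastLedgerCubic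

/-!
# `SymmetryModuliCount.ForcedSymmetry` (crux stmt-NavierStokesRegularity-4052), line
# `recurrent-closing`, stub `stub_slabProfileOfBounds`: packaging a Type-I ancient mild field
# with a global classical pressure into Albritton–Barker's slab class

Support file (everything proved, kind = proof) for the lead's skeleton of the line
`recurrent-closing` (`Cruxes/ForcedSymmetry/Lines/recurrent_closing.lean`), sub-stub 1e
`stub_slabProfileOfBounds`.  For `u ∈ A_C` (`IsTypeIAncientMild C u`: jointly smooth on `t < 0`,
`‖u‖ ≤ C/√(−t)`) carrying the far-past ledger `∫_{B(x₀,R)} ‖u(t)‖² ≤ K R`, a classical pressure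
`p` on the whole time set `(−∞, 0)` and the uniform mean-free pressure bound
`D_osc(Q(z, r); p) ≤ D₁` on every parabolic ball of the slab (`r > 0`, `z.1 ≤ 0`):

* `(u, p)` is a suitable weak solution on the slab `ℝ³ × (−∞, 0)` (classical ⇒ suitable,
  `IsClassicalNSSolutionOnRegion.isSuitableWeakSolutionOn_of_subset`);
* `∇u = (t, x) ↦ D(u t)(x)` is a weak spatial gradient on the slab
  (`hasWeakSpatialGradientOn_of_contDiffOn`);
* Albritton–Barker's `𝐈(ℝ³ × ℝ₋) < ∞`: on an admissible ball `Q(z, r) ⊆ ℝ₋ × ℝ³` one has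
  `z.1 ≤ 0` (`ParabolicBump.fst_nonpos_of_subset`), `C(Q(z, r)) ≤ 2CK` (`cknC_le_of_ledger`),
  `D_osc(Q(z, r)) ≤ D₁` (hypothesis), and `A(Q(z, r)) + E(Q(z, r))` is bounded by the local
  energy bound at cylinders touching the top (`Seregin2020.localEnergyBound_top` on `Q(z, 2r)` —
  a sub-region of the slab since `z.1 ≤ 0` — for the pressure normalised by its
  `B(z.2, 2r)`-means, which is again suitable (`IsSuitableWeakSolutionOn.sub_pressure`, the means
  being locally `L^{3/2}` in the open cylinder, `memLp_ballMean_of_compact`) and whose plain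
  pressure quantity `D(Q(z, 2r))` IS the mean-free `D_osc(Q(z, 2r); p) ≤ D₁`
  (`localEnergyBound_slab`)).

## References

* D. Albritton, T. Barker, *On local Type I singularities of the Navier–Stokes equations and
  Liouville theorems*, J. Math. Fluid Mech. 21 (2019), Def. 2.1, Lemma 2.2, §3.
  [AlbrittonBarker2019]
* T.-P. Tsai, *On Leray's self-similar solutions of the Navier–Stokes equations satisfying local
  energy estimates*, Arch. Rational Mech. Anal. 143 (1998), remark after Lemma 4.2. [Tsai1998]
* L. Caffarelli, R. Kohn, L. Nirenberg, Comm. Pure Appl. Math. 35 (1982), §2.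
  [CaffarelliKohnNirenberg1982]
-/

noncomputable section

set_option linter.dupNamespace false

open MeasureTheory Set Metric Function Filter Topology TopologicalSpace
open scoped ENNReal NNReal

namespace Summit.NavierStokesRegularity.NavierStokesRegularity.Theorems.SymmetryModuliCountForcedSymmetry

open Literature.Analysis.FluidPDE

section BallMeans

variable {u : ℝ → EuclideanSpace ℝ (Fin 3) → EuclideanSpace ℝ (Fin 3)}
  {p : ℝ → EuclideanSpace ℝ (Fin 3) → ℝ}

/-! ### The ball means of the slab pressure -/

/-- **The ball means of the slab pressure are locally `L^{3/2}` in a parabolic ball of the slab.**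
Let `(u, p)` be a suitable weak solution on the slab `ℝ³ × (−∞, 0)`, `r > 0`, `z.1 ≤ 0`, and
`K ⊆ Q(z, r)` compact, with `T = fst '' K` (a compact set of times `< z.1 ≤ 0`).  Then the mean
`t ↦ ⨍_{B(z.2, r)} p(t, y) dy`, as a space–time function, is in `L^{3/2}(T × B(z.2, r))`, and
`K ⊆ T × B(z.2, r)` (the pressure class of the slab on the compact `T × B̄(z.2, r)` and
`memLp_setAverage_slice`). [folklore] -/
theorem memLp_ballMean_of_compact
    (hsw : IsSuitableWeakSolutionOn (slab (EuclideanSpace ℝ (Fin 3)) (Iio (0 : ℝ)) isOpen_Iio) 1 0 u p)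
    {r : ℝ} (hr : 0 < r) {z : ℝ × EuclideanSpace ℝ (Fin 3)} (hz : z.1 ≤ 0)
    {K : Set (ℝ × EuclideanSpace ℝ (Fin 3))} (hK : IsCompact K)
    (hKQ : K ⊆ parabolicCylinder r z) :
    MemLp (fun w : ℝ × EuclideanSpace ℝ (Fin 3) => ⨍ y in ball z.2 r, p w.1 y) (3 / 2)
        (volume.restrict ((Prod.fst '' K) ×ˢ ball z.2 r)) ∧
      K ⊆ (Prod.fst '' K) ×ˢ ball z.2 r := by
  -- adapted from `Literature.Analysis.FluidPDE.memLp_mean_of_compact` (unit ball at the origin)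
  obtain ⟨h32, h32', h32r⟩ := threeHalves_facts
  set T : Set ℝ := Prod.fst '' K with hT
  have hTc : IsCompact T := hK.image continuous_fst
  have hKT : K ⊆ T ×ˢ ball z.2 r := fun w hw =>
    ⟨mem_image_of_mem _ hw, (mem_parabolicCylinder.1 (hKQ hw)).2⟩
  have hK' : IsCompact (T ×ˢ closedBall z.2 r) := hTc.prod (isCompact_closedBall _ _)
  have hK'sub : T ×ˢ closedBall z.2 r ⊆
      ((slab (EuclideanSpace ℝ (Fin 3)) (Iio (0 : ℝ)) isOpen_Iio :
        Opens (ℝ × EuclideanSpace ℝ (Fin 3))) : Set (ℝ × EuclideanSpace ℝ (Fin 3))) := by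
    rintro ⟨t, x⟩ ⟨ht, -⟩
    obtain ⟨w, hw, hwt⟩ := ht
    have h := (mem_parabolicCylinder.1 (hKQ hw)).1.2
    rw [coe_slab]
    refine ⟨?_, mem_univ _⟩
    have hwt' : w.1 = t := hwt
    show t < 0
    rw [← hwt']
    exact lt_of_lt_of_le h hz
  have hfin := hsw.pressure _ hK'sub hK'
  have hsub : T ×ˢ ball z.2 r ⊆ T ×ˢ closedBall z.2 r :=
    prod_mono Subset.rfl ball_subset_closedBall
  have hpm : MemLp (uncurry p) (3 / 2) (volume.restrict (T ×ˢ ball z.2 r)) := by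
    have hli : LocallyIntegrableOn (uncurry p) _ volume := hsw.distributional.2.2.1
    refine ⟨hli.aestronglyMeasurable.mono_measure
      (Measure.restrict_mono (hsub.trans hK'sub) le_rfl), ?_⟩
    rw [eLpNorm_eq_lintegral_rpow_enorm_toReal (zero_lt_one.trans_le h32).ne' h32', h32r]
    refine ENNReal.rpow_lt_top_of_nonneg (by positivity) ?_
    exact (lt_of_le_of_lt (lintegral_mono_set hsub) hfin).ne
  exact ⟨memLp_setAverage_slice (measure_ball_pos volume _ hr).ne' measure_ball_lt_top.ne
    h32 h32' hpm, hKT⟩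

/-- **The ball means are admissible for `sub_pressure` on the open ball.**  For a suitable weak
solution on the slab, `r > 0`, `z.1 ≤ 0`: on every compact `K ⊆ Q(z, r)` the space–time function
`(t, x) ↦ ⨍_{B(z.2, r)} p(t, y) dy` is integrable and has `∫_K |·|^{3/2} < ∞`. [folklore] -/
theorem integrableOn_ballMean_of_compact
    (hsw : IsSuitableWeakSolutionOn (slab (EuclideanSpace ℝ (Fin 3)) (Iio (0 : ℝ)) isOpen_Iio) 1 0 u p)
    {r : ℝ} (hr : 0 < r) {z : ℝ × EuclideanSpace ℝ (Fin 3)} (hz : z.1 ≤ 0)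
    {K : Set (ℝ × EuclideanSpace ℝ (Fin 3))} (hK : IsCompact K)
    (hKQ : K ⊆ parabolicCylinder r z) :
    IntegrableOn (fun w : ℝ × EuclideanSpace ℝ (Fin 3) => ⨍ y in ball z.2 r, p w.1 y) K volume ∧
      ∫⁻ w in K, ‖⨍ y in ball z.2 r, p w.1 y‖ₑ ^ (3 / 2 : ℝ) < ∞ := by
  -- adapted from `Literature.Analysis.FluidPDE.isLocalTypeISingularPoint_of_slabProfile` (`hcK`)
  obtain ⟨h32, h32', h32r⟩ := threeHalves_facts
  obtain ⟨hmean, hKT⟩ := memLp_ballMean_of_compact hsw hr hz hK hKQ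
  haveI : IsFiniteMeasure (volume.restrict ((Prod.fst '' K) ×ˢ ball z.2 r)) := by
    refine ⟨?_⟩
    rw [Measure.restrict_apply_univ]
    exact lt_of_le_of_lt (measure_mono (prod_mono Subset.rfl ball_subset_closedBall))
      ((hK.image continuous_fst).prod (isCompact_closedBall z.2 r)).measure_lt_top
  have h1 : IntegrableOn (fun w : ℝ × EuclideanSpace ℝ (Fin 3) => ⨍ y in ball z.2 r, p w.1 y)
      ((Prod.fst '' K) ×ˢ ball z.2 r) volume :=
    hmean.integrable h32
  refine ⟨h1.mono_set hKT, ?_⟩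
  have hfin := hmean.eLpNorm_lt_top
  rw [eLpNorm_eq_lintegral_rpow_enorm_toReal (zero_lt_one.trans_le h32).ne' h32', h32r] at hfin
  exact lt_of_le_of_lt (lintegral_mono_set hKT)
    ((ENNReal.rpow_lt_top_iff_of_pos (by norm_num)).1 hfin)

end BallMeans

/-! ### The local energy bound on the slab, with the mean-free pressure quantity -/

/-- **Local energy bound on the backward slab with Albritton–Barker's mean-free `D`.**  There
are constants `c₁, c₂, c₃` such that for every suitable weak solution `(u, p)` of the unforced
Navier–Stokes equations (`ν = 1`) on the slab `ℝ³ × (−∞, 0)`, every weak spatial gradient `G`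
of `u` on the slab, every centre `z` with `z.1 ≤ 0` and every `R > 0`:
`A(Q(z,R/2)) + E(Q(z,R/2)) ≤ c₁ C(Q(z,R))^{2/3} + c₂ C(Q(z,R)) + c₃ D_osc(Q(z,R))^{2/3} C(Q(z,R))^{1/3}`.
Proof: `Seregin2020.localEnergyBound_top` on the open ball `Q(z, R) ⊆` slab applied to the pair
`(u, p − [p]_{B(z.2,R)}(t))`, which is again a suitable weak solution there
(`IsSuitableWeakSolutionOn.sub_pressure`, the means being locally integrable and locally
`L^{3/2}` by `integrableOn_ballMean_of_compact`), and whose plain pressure quantity `D` is by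
definition the mean-free `D_osc` of `p`.
[cite: Tsai1998, remark after Lemma 4.2 (p. 46); AlbrittonBarker2019, Lemma 2.2] -/
theorem localEnergyBound_slab :
    ∃ c₁ c₂ c₃ : ℝ≥0, ∀ (u : ℝ → EuclideanSpace ℝ (Fin 3) → EuclideanSpace ℝ (Fin 3))
      (p : ℝ → EuclideanSpace ℝ (Fin 3) → ℝ)
      (G : ℝ → EuclideanSpace ℝ (Fin 3) → EuclideanSpace ℝ (Fin 3) →L[ℝ] EuclideanSpace ℝ (Fin 3)),
      IsSuitableWeakSolutionOn (slab (EuclideanSpace ℝ (Fin 3)) (Iio (0 : ℝ)) isOpen_Iio) 1 0 u p →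
      HasWeakSpatialGradientOn (slab (EuclideanSpace ℝ (Fin 3)) (Iio (0 : ℝ)) isOpen_Iio) u G →
      ∀ (z : ℝ × EuclideanSpace ℝ (Fin 3)), z.1 ≤ 0 → ∀ R : ℝ, 0 < R →
        cknAEss (R / 2) z u + cknE (R / 2) z G ≤
          c₁ * cknC R z u ^ (2 / 3 : ℝ) + c₂ * cknC R z u +
            c₃ * (cknDOsc R z p ^ (2 / 3 : ℝ) * cknC R z u ^ (1 / 3 : ℝ)) := by
  obtain ⟨c₁, c₂, c₃, H⟩ := Seregin2020.localEnergyBound_top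
  refine ⟨c₁, c₂, c₃, fun u p G hsw hwg z hz R hR => ?_⟩
  have hle : parabolicCylinderOpens R z ≤
      (slab (EuclideanSpace ℝ (Fin 3)) (Iio (0 : ℝ)) isOpen_Iio : Opens (ℝ × EuclideanSpace ℝ (Fin 3))) :=
    parabolicCylinderOpens_le_slab R hz
  have hswQ := hsw.of_le hle
  have hwgQ := hwg.mono hle
  -- the ball means of the pressure are locally integrable and locally `L^{3/2}` on the open ball
  have hcK : ∀ K ⊆ ((parabolicCylinderOpens R z : Opens (ℝ × EuclideanSpace ℝ (Fin 3))) :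
      Set (ℝ × EuclideanSpace ℝ (Fin 3))), IsCompact K →
      IntegrableOn (fun w : ℝ × EuclideanSpace ℝ (Fin 3) => ⨍ y in ball z.2 R, p w.1 y) K volume ∧
        ∫⁻ w in K, ‖⨍ y in ball z.2 R, p w.1 y‖ₑ ^ (3 / 2 : ℝ) < ∞ :=
    fun K hKQ hK => integrableOn_ballMean_of_compact hsw hR hz hK hKQ
  have hcli : LocallyIntegrableOn (fun w : ℝ × EuclideanSpace ℝ (Fin 3) => ⨍ y in ball z.2 R, p w.1 y)
      ((parabolicCylinderOpens R z : Opens (ℝ × EuclideanSpace ℝ (Fin 3))) :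
        Set (ℝ × EuclideanSpace ℝ (Fin 3))) volume :=
    (locallyIntegrableOn_iff (isOpen_parabolicCylinder R z).isLocallyClosed).2
      fun K hKQ hK => (hcK K hKQ hK).1
  have hswQ' : IsSuitableWeakSolutionOn (parabolicCylinderOpens R z) 1 0 u
      (fun t x => p t x - ⨍ y in ball z.2 R, p t y) :=
    hswQ.sub_pressure (c := fun t => ⨍ y in ball z.2 R, p t y) hcli
      fun K hKQ hK => (hcK K hKQ hK).2
  have key := H _ u _ G hswQ' hwgQ z R hR subset_rfl
  -- the plain `D` of the normalised pressure is the mean-free `D_osc` of `p`, by definition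
  have hD : cknD R z (fun t x => p t x - ⨍ y in ball z.2 R, p t y) = cknDOsc R z p := rfl
  rw [hD] at key
  exact key

/-! ### The stub -/

/-- **Sub-stub 1e — packaging into Albritton–Barker's slab class.**  A `u ∈ A_C` with ledger
constant `K`, a classical pressure `p` on `(−∞,0)` and the uniform mean-free pressure bound
`D_osc(Q(z,r); p) ≤ D₁` on all parabolic balls of the slab is a suitable weak solution on the slab
`ℝ³ × (−∞,0)` (classical ⇒ suitable), with weak spatial gradient `∇u`
(`hasWeakSpatialGradientOn_of_contDiffOn`) and `𝐈(ℝ³ × ℝ₋) < ∞`: `A + E` from the local energy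
bound at cylinders touching the top (`localEnergyBound_slab` on `Q(z,2r)`, i.e.
`Seregin2020.localEnergyBound_top` with the pressure normalised by its `B(z.2,2r)`-means),
`C ≤ 2CK` (`cknC_le_of_ledger`), `D_osc ≤ D₁`.
[cite: AlbrittonBarker2019, Def. 2.1, Lemma 2.2 and §3; Tsai1998, remark after Lemma 4.2] -/
theorem stub_slabProfileOfBounds :
    ∀ (C K D₁ : ℝ) (u : ℝ → EuclideanSpace ℝ (Fin 3) → EuclideanSpace ℝ (Fin 3)) (p : ℝ → EuclideanSpace ℝ (Fin 3) → ℝ),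
      IsTypeIAncientMild C u →
      (∀ t < 0, ∀ (x₀ : EuclideanSpace ℝ (Fin 3)) (R : ℝ), 0 < R → ∫ x in ball x₀ R, ‖u t x‖ ^ 2 ≤ K * R) →
      IsClassicalNSSolutionOn (Set.Iio 0) 1 0 u p →
      (∀ (r : ℝ), 0 < r → ∀ z : ℝ × EuclideanSpace ℝ (Fin 3), z.1 ≤ 0 → cknDOsc r z p ≤ ENNReal.ofReal D₁) →
      IsSuitableWeakSolutionOn (slab (EuclideanSpace ℝ (Fin 3)) (Set.Iio 0) isOpen_Iio) 1 0 u p ∧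
      HasWeakSpatialGradientOn (slab (EuclideanSpace ℝ (Fin 3)) (Set.Iio 0) isOpen_Iio) u
        (fun t x => fderiv ℝ (u t) x) ∧
      typeIBound (Set.Iio (0 : ℝ) ×ˢ Set.univ) u p (fun t x => fderiv ℝ (u t) x) < ⊤ := by
  intro C K D₁ u p hu hK hp hD
  have hQ : ((slab (EuclideanSpace ℝ (Fin 3)) (Iio (0 : ℝ)) isOpen_Iio :
      Opens (ℝ × EuclideanSpace ℝ (Fin 3))) : Set (ℝ × EuclideanSpace ℝ (Fin 3))) ⊆
        Iio (0 : ℝ) ×ˢ univ := by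
    rw [coe_slab]
  -- (A) classical solutions on the open slab are suitable weak solutions there
  have hsw : IsSuitableWeakSolutionOn (slab (EuclideanSpace ℝ (Fin 3)) (Iio (0 : ℝ)) isOpen_Iio)
      1 0 u p :=
    hp.onRegion.isSuitableWeakSolutionOn_of_subset one_pos hQ
  -- (B) the classical slice derivative is a weak spatial gradient
  have hwg : HasWeakSpatialGradientOn (slab (EuclideanSpace ℝ (Fin 3)) (Iio (0 : ℝ)) isOpen_Iio) u
      (fun t x => fderiv ℝ (u t) x) :=
    hasWeakSpatialGradientOn_of_contDiffOn isOpen_Iio hQ (hu.contDiffOn.of_le (by norm_cast))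
  refine ⟨hsw, hwg, ?_⟩
  -- (C) `𝐈(ℝ³ × ℝ₋) ≤ B + 2CK + D₁ < ∞`
  obtain ⟨c₁, c₂, c₃, H⟩ := localEnergyBound_slab
  set Cst : ℝ≥0∞ := ENNReal.ofReal (2 * C * K) with hCst
  set Dst : ℝ≥0∞ := ENNReal.ofReal D₁ with hDst
  set B : ℝ≥0∞ := c₁ * Cst ^ (2 / 3 : ℝ) + c₂ * Cst +
    c₃ * (Dst ^ (2 / 3 : ℝ) * Cst ^ (1 / 3 : ℝ)) with hB
  have hBtop : B ≠ ∞ := by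
    have h1 : Cst ^ (2 / 3 : ℝ) ≠ ∞ :=
      ENNReal.rpow_ne_top_of_nonneg (by norm_num) ENNReal.ofReal_ne_top
    have h2 : Cst ^ (1 / 3 : ℝ) ≠ ∞ :=
      ENNReal.rpow_ne_top_of_nonneg (by norm_num) ENNReal.ofReal_ne_top
    have h3 : Dst ^ (2 / 3 : ℝ) ≠ ∞ :=
      ENNReal.rpow_ne_top_of_nonneg (by norm_num) ENNReal.ofReal_ne_top
    exact ENNReal.add_ne_top.2 ⟨ENNReal.add_ne_top.2 ⟨ENNReal.mul_ne_top ENNReal.coe_ne_top h1,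
      ENNReal.mul_ne_top ENNReal.coe_ne_top ENNReal.ofReal_ne_top⟩,
      ENNReal.mul_ne_top ENNReal.coe_ne_top (ENNReal.mul_ne_top h3 h2)⟩
  have hfin : B + Cst + Dst < ⊤ :=
    ENNReal.add_lt_top.2 ⟨ENNReal.add_lt_top.2 ⟨hBtop.lt_top, ENNReal.ofReal_lt_top⟩,
      ENNReal.ofReal_lt_top⟩
  refine lt_of_le_of_lt (typeIBound_le_iff.2 fun r hr z hzω => ?_) hfin
  have hz : z.1 ≤ 0 := ParabolicBump.fst_nonpos_of_subset hr hzω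
  have hC1 : cknC r z u ≤ Cst := AxisymEndLiouvilleOfFarPastLedger.cknC_le_of_ledger hu hK hz hr
  have hC2 : cknC (2 * r) z u ≤ Cst :=
    AxisymEndLiouvilleOfFarPastLedger.cknC_le_of_ledger hu hK hz (by positivity)
  have hD1 : cknDOsc r z p ≤ Dst := hD r hr z hz
  have hD2 : cknDOsc (2 * r) z p ≤ Dst := hD (2 * r) (by positivity) z hz
  -- `A + E` on `Q(z, r)` from the local energy bound on `Q(z, 2r)`
  have hAE : cknAEss r z u + cknE r z (fun t x => fderiv ℝ (u t) x) ≤ B := by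
    have key := H u p _ hsw hwg z hz (2 * r) (by positivity)
    rw [show 2 * r / 2 = r by ring] at key
    refine key.trans ?_
    rw [hB]
    gcongr
  calc abScaledSum r z u p (fun t x => fderiv ℝ (u t) x)
      = (cknAEss r z u + cknE r z (fun t x => fderiv ℝ (u t) x)) + cknC r z u + cknDOsc r z p := by
        unfold abScaledSum; ring
    _ ≤ B + Cst + Dst := add_le_add (add_le_add hAE hC1) hD1

end Summit.NavierStokesRegularity.NavierStokesRegularity.Theorems.SymmetryModuliCountForcedSymmetry

end
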